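import Literature.NumberTheory.DiophantineGeometry.BelyiTheorem
import Literature.NumberTheory.EllipticCurves.EisensteinValuesAtRhoSix
import Literature.NumberTheory.EllipticCurves.ComplexPeriodProofs
import Literature.NumberTheory.EllipticCurves.SilvermanHeightLogDiscriminantProofs
import Mathlib.AlgebraicGeometry.EllipticCurve.IsomOfJ
import Mathlib.Analysis.SpecialFunctions.Gamma.BohrMollerup
import HarnessLib

/-!
# The stable Faltings height of the elliptic curves with `j = 0` and `j = 1728`

Topic `NumberTheory/DiophantineGeometry`; in the orbit of the named fact
`javanpeykar2014_stableFaltingsHeight_le` (`h_F(E) ≤ 13·10⁶ deg_B(E)⁵`), whose curves of Belyi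
degree `3` are exactly the curves with `j = 0` (`BelyiDegreeThreeJZero`). With the tree's closed
formula for the stable Faltings height (`WeierstrassCurve.stableFaltingsHeight`,
[cite: Silverman1986, Prop. 1.1 and §2]):
`h_F(E) = (12[K:ℚ])⁻¹ (log N(𝔇_j) − Σ_{σ : K → ℂ} (log|Δ_σ| + 6 log((i/2)∫_{E_σ(ℂ)} ω ∧ ω̄)))`,
we COMPUTE `h_F(E)` for every elliptic curve `E` with `j(E) = 0` over every number field:

* over `ℂ`, every `j = 0` curve is isomorphic to `W_ρ : y² = x³ − g₃/4` whose period lattice is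
  the Eisenstein lattice `Λ_ρ = ℤρ + ℤ` (`g₂(Λ_ρ) = 0`, `g₃ = g₃(Λ_ρ) = Γ(1/3)¹⁸/(64π⁶)`, the
  tree's `EisensteinLattice.g₃_eq_Gamma`), so `Δ = −27 g₃²`, `(i/2)∫ ω ∧ ω̄ = covol(Λ_ρ) = √3/2`,
  and the archimedean term is `log(729/64) + 2 log g₃(Λ_ρ)` for EVERY complex embedding
  (**`faltingsArchTerm_of_j_eq_zero`**);
* `j = 0` is integral, so `𝔇_j = (1)`;
* hence **`stableFaltingsHeight_of_j_eq_zero`**: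
  `h_F(E) = −(1/12) log(729/64) − (1/6) log(Γ(1/3)¹⁸/(64π⁶))` (`≈ −1.3`, in the normalization of
  `WeierstrassCurve.stableFaltingsHeight`), a Chowla–Selberg / Deligne type evaluation;
* and the crude bound **`stableFaltingsHeight_le_three_of_j_eq_zero`** (`Γ(1/3) ≥ 1` by the
  log-convexity of `Γ`, `π ≤ 4`), which makes Javanpeykar's inequality unconditional for the
  curves with `j = 0`: **`javanpeykar2014_stableFaltingsHeight_le_of_j_eq_zero`** (the named fact
  `javanpeykar2014_stableFaltingsHeight_le` restricted to `j(E) = 0`, i.e. to the curves of Belyi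
  degree `3`, `BelyiDegreeThreeJZero`);
* the same for **`j = 1728`** with the Gaussian lattice `Λ_i = ℤi + ℤ` (`g₃(Λ_i) = 0`,
  `g₂(Λ_i) = Γ(1/4)⁸/(16π²)`, `GaussianLattice.g₂_eq_Gamma`; model `W_i : y² = x³ − (g₂/4)x`,
  `Δ = g₂³`, `covol = 1`): **`stableFaltingsHeight_of_j_eq_1728`**
  (`h_F(E) = −(1/4) log(Γ(1/4)⁸/(16π²))`), `stableFaltingsHeight_le_three_of_j_eq_1728`,
  **`javanpeykar2014_stableFaltingsHeight_le_of_j_eq_1728`** (curves of Belyi degree `4`).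

## References

* J. H. Silverman, *Heights and elliptic curves*, in: Arithmetic Geometry (Cornell–Silverman,
  eds.), Springer 1986, Prop. 1.1, §2. [Silverman1986]
* M. Waldschmidt, *Elliptic functions and transcendence*, Dev. Math. 17 (2008), §2.3 (6).
  [Waldschmidt2008EllipticSurvey]
* P. Deligne, *Preuve des conjectures de Tate et de Shafarevitch*, Sém. Bourbaki 616 (1983/84),
  §1 (c) (the height of CM elliptic curves via Chowla–Selberg).
* A. Javanpeykar, *Polynomial bounds for Arakelov invariants of Belyi curves*, Algebra & Number
  Theory 8 (2014), Thm. 1.1.1. [Javanpeykar2014]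
-/

noncomputable section

open scoped Classical
open Complex PeriodPair NumberField
open Literature.NumberTheory.EllipticCurves

namespace Literature.NumberTheory.DiophantineGeometry

namespace FaltingsHeightJZero

/-! ### The model `W_ρ : y² = x³ − g₃(Λ_ρ)/4` over `ℂ` -/

/-- `g₃(Λ_ρ)`, the invariant of the Eisenstein lattice `ℤρ + ℤ` (`= Γ(1/3)¹⁸/(64π⁶) > 0`).
We use it through `EisensteinLattice.g₃_eq_Gamma`. [folklore] -/
abbrev γ : ℂ := (ofUpperHalfPlane UpperHalfPlane.ρ).g₃

/-- `g₃(Λ_ρ) = Γ(1/3)¹⁸/(64π⁶)`, as a real number cast.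
[cite: Waldschmidt2008EllipticSurvey, §2.3 (6)] -/
theorem γ_eq : γ = ((Real.Gamma (1 / 3) ^ 18 / (64 * Real.pi ^ 6) : ℝ) : ℂ) := by
  rw [γ, EisensteinLattice.g₃_eq_Gamma]; push_cast; ring

/-- `g₃(Λ_ρ) > 0` (as a real number). [folklore] -/
theorem γ_re_pos : 0 < Real.Gamma (1 / 3) ^ 18 / (64 * Real.pi ^ 6) := by
  have h := EisensteinLattice.g₃_re_pos
  rw [show (ofUpperHalfPlane UpperHalfPlane.ρ).g₃ = γ from rfl, γ_eq, Complex.ofReal_re] at h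
  exact h

/-- `g₃(Λ_ρ) ≠ 0`. [folklore] -/
theorem γ_ne_zero : γ ≠ 0 := by
  rw [γ_eq, Complex.ofReal_ne_zero]; exact γ_re_pos.ne'

/-- The model `W_ρ : y² = x³ − g₃(Λ_ρ)/4`, whose period lattice for `ω = dx/(2y)` is `Λ_ρ`
(`c₄ = 0 = 12 g₂(Λ_ρ)`, `c₆ = 216 g₃(Λ_ρ)`). [folklore] -/
def Wρ : WeierstrassCurve ℂ := ⟨0, 0, 0, 0, -(γ / 4)⟩

/-- `c₄(W_ρ) = 0`. [folklore] -/
theorem Wρ_c₄ : Wρ.c₄ = 0 := by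
  simp [Wρ, WeierstrassCurve.c₄, WeierstrassCurve.b₂, WeierstrassCurve.b₄]

/-- `c₆(W_ρ) = 216 g₃(Λ_ρ)`. [folklore] -/
theorem Wρ_c₆ : Wρ.c₆ = 216 * γ := by
  simp [Wρ, WeierstrassCurve.c₆, WeierstrassCurve.b₂, WeierstrassCurve.b₄, WeierstrassCurve.b₆]
  ring

/-- `Δ(W_ρ) = −27 g₃(Λ_ρ)²`. [folklore] -/
theorem Wρ_Δ : Wρ.Δ = -27 * γ ^ 2 := by
  simp [Wρ, WeierstrassCurve.Δ, WeierstrassCurve.b₂, WeierstrassCurve.b₄, WeierstrassCurve.b₆,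
    WeierstrassCurve.b₈]
  ring

/-- `W_ρ` is an elliptic curve (`g₃(Λ_ρ) ≠ 0`). [folklore] -/
instance Wρ_isElliptic : Wρ.IsElliptic :=
  ⟨by rw [isUnit_iff_ne_zero, Wρ_Δ]; exact mul_ne_zero (by norm_num) (pow_ne_zero 2 γ_ne_zero)⟩

/-- `j(W_ρ) = 0`. [folklore] -/
theorem Wρ_j : Wρ.j = 0 := Wρ.j_eq_zero Wρ_c₄

/-- **The complex period of `W_ρ` is `2 covol(Λ_ρ) = √3`.** (`complexPeriod_eq_two_mul_covolume'`
with the Eisenstein period pair, `g₂(Λ_ρ) = 0 = c₄/12`, `g₃(Λ_ρ) = c₆/216`, and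
`covol(ℤτ + ℤ) = Im τ`.) [cite: SilvermanAEC2009, Thm VI.5.1] -/
theorem Wρ_complexPeriod : Wρ.complexPeriod = Real.sqrt 3 := by
  rw [WeierstrassCurve.complexPeriod_eq_two_mul_covolume' (W := Wρ)
      (L := ofUpperHalfPlane UpperHalfPlane.ρ) (by rw [g₂_ofUpperHalfPlane_ρ, Wρ_c₄, zero_div])
      (by rw [Wρ_c₆]; ring),
    ModularForms.covolume_ofUpperHalfPlane_lattice]
  rw [show UpperHalfPlane.im UpperHalfPlane.ρ = Real.sqrt 3 / 2 from rfl]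
  ring

/-- **The archimedean term of `W_ρ`: `log|Δ| + 6 log((i/2)∫ω∧ω̄) = log(729/64) + 2 log g₃(Λ_ρ)`.**
[cite: Silverman1986, Prop. 1.1] -/
theorem Wρ_faltingsArchTerm :
    Wρ.faltingsArchTerm = Real.log (729 / 64) +
      2 * Real.log (Real.Gamma (1 / 3) ^ 18 / (64 * Real.pi ^ 6)) := by
  have hγ := γ_re_pos
  set g : ℝ := Real.Gamma (1 / 3) ^ 18 / (64 * Real.pi ^ 6) with hg
  rw [WeierstrassCurve.faltingsArchTerm, Wρ_Δ, Wρ_complexPeriod, γ_eq, ← hg]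
  have hnorm : ‖(-27 : ℂ) * (g : ℂ) ^ 2‖ = 27 * g ^ 2 := by
    rw [norm_mul, norm_neg, norm_pow, Complex.norm_real, Real.norm_of_nonneg hγ.le]
    norm_num
  rw [hnorm]
  have h3 : Real.sqrt 3 / 2 = Real.sqrt (3 / 4) := by
    rw [Real.sqrt_div (by norm_num : (0:ℝ) ≤ 3), show (4 : ℝ) = 2 ^ 2 by norm_num,
      Real.sqrt_sq (by norm_num : (0:ℝ) ≤ 2)]
  have hlog34 : Real.log (Real.sqrt 3 / 2) = Real.log (3 / 4) / 2 := by
    rw [h3, Real.log_sqrt (by norm_num)]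
  rw [hlog34, Real.log_mul (by norm_num) (pow_ne_zero 2 hγ.ne'), Real.log_pow,
    show (729 / 64 : ℝ) = 27 * (3 / 4) ^ 3 by norm_num,
    Real.log_mul (by norm_num) (by norm_num), Real.log_pow]
  push_cast
  ring

/-- **Every complex elliptic curve with `j = 0` has the archimedean term of `W_ρ`** (it is
`ℂ`-isomorphic to `W_ρ`, Mathlib `exists_variableChange_of_j_eq`, and the term is a model
invariant, `faltingsArchTerm_smul`). [cite: Silverman1986, proof of Prop. 1.1 (p. 255)] -/
theorem faltingsArchTerm_of_j_eq_zero (V : WeierstrassCurve ℂ) [V.IsElliptic] (hj : V.j = 0) :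
    V.faltingsArchTerm = Real.log (729 / 64) +
      2 * Real.log (Real.Gamma (1 / 3) ^ 18 / (64 * Real.pi ^ 6)) := by
  obtain ⟨C, hC⟩ := WeierstrassCurve.exists_variableChange_of_j_eq V Wρ (hj.trans Wρ_j.symm)
  rw [← Wρ_faltingsArchTerm, ← hC, WeierstrassCurve.faltingsArchTerm_smul]

end FaltingsHeightJZero

open FaltingsHeightJZero

/-! ### The height -/

/-- **The stable Faltings height of a `j = 0` curve over a number field**:
`h_F(E) = −(1/12) log(729/64) − (1/6) log(Γ(1/3)¹⁸/(64π⁶))` — `j = 0` is integral, so the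
denominator ideal of `j` is `(1)`, and each of the `[K:ℚ]` complex embeddings contributes the
archimedean term of `W_ρ` (`faltingsArchTerm_of_j_eq_zero`).
[cite: Silverman1986, Prop. 1.1 and §2] [cite: Waldschmidt2008EllipticSurvey, §2.3 (6)] -/
theorem stableFaltingsHeight_of_j_eq_zero {K : Type*} [Field K] [NumberField K]
    (W : WeierstrassCurve K) [W.IsElliptic] (hj : W.j = 0) :
    W.stableFaltingsHeight = -(1 / 12) * Real.log (729 / 64) -
      (1 / 6) * Real.log (Real.Gamma (1 / 3) ^ 18 / (64 * Real.pi ^ 6)) := by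
  -- the denominator ideal of `j = 0` is `(1)`
  have htop : W.jDenominatorIdeal = ⊤ := by
    rw [Ideal.eq_top_iff_one, WeierstrassCurve.one_mem_jDenominatorIdeal_iff]
    exact ⟨0, by rw [hj]; simp⟩
  -- each embedding contributes the same term
  have hσ : ∀ σ : K →+* ℂ, (W.map σ).faltingsArchTerm = Real.log (729 / 64) +
      2 * Real.log (Real.Gamma (1 / 3) ^ 18 / (64 * Real.pi ^ 6)) := fun σ ↦ by
    haveI : (W.map σ).IsElliptic := by infer_instance
    exact faltingsArchTerm_of_j_eq_zero _ (by rw [WeierstrassCurve.map_j, hj, map_zero])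
  have hd : (Module.finrank ℚ K : ℝ) ≠ 0 := by
    exact_mod_cast (Module.finrank_pos (R := ℚ) (M := K)).ne'
  rw [WeierstrassCurve.stableFaltingsHeight, htop, Ideal.absNorm_top, Nat.cast_one, Real.log_one,
    Finset.sum_congr rfl fun σ _ ↦ hσ σ, Finset.sum_const, Finset.card_univ,
    NumberField.Embeddings.card K ℂ, nsmul_eq_mul]
  field_simp
  ring

/-- `Γ(x) ≥ 1` for `0 < x ≤ 1` (log-convexity of `Γ` on `(0, ∞)` through `Γ(1) = Γ(2) = 1`).
[folklore] -/
theorem one_le_Gamma_of_le_one {x : ℝ} (hx0 : 0 < x) (hx1 : x ≤ 1) : 1 ≤ Real.Gamma x := by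
  rcases hx1.eq_or_lt with rfl | hx1
  · rw [Real.Gamma_one]
  -- `1 = (1 - t) x + t 2` with `t = (1 - x)/(2 - x)`
  have hconv := Real.convexOn_log_Gamma
  set t : ℝ := (1 - x) / (2 - x) with ht
  have h2x : 0 < 2 - x := by linarith
  have ht0 : 0 ≤ t := div_nonneg (by linarith) h2x.le
  have ht1 : t ≤ 1 := (div_le_one h2x).2 (by linarith)
  have hcomb : (1 - t) * x + t * 2 = 1 := by
    rw [ht]; field_simp; ring
  have key := hconv.2 (Set.mem_Ioi.2 hx0) (Set.mem_Ioi.2 (by norm_num : (0:ℝ) < 2))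
    (sub_nonneg.2 ht1) ht0 (by ring)
  simp only [smul_eq_mul, Function.comp_apply] at key
  rw [hcomb, Real.Gamma_one, Real.log_one, Real.Gamma_two, Real.log_one, mul_zero, add_zero]
    at key
  -- `0 ≤ (1 - t) log Γ(x)` with `1 - t > 0`
  have h1t : 0 < 1 - t := by
    rw [ht, sub_pos, div_lt_one h2x]; linarith
  have hlog : 0 ≤ Real.log (Real.Gamma x) := by
    by_contra hneg
    push Not at hneg
    have := mul_neg_of_pos_of_neg h1t hneg
    linarith
  rw [← Real.exp_log (Real.Gamma_pos_of_pos hx0)]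
  exact Real.one_le_exp hlog

/-- **`h_F(E) ≤ 3` for every elliptic curve with `j = 0` over a number field** (crude:
`Γ(1/3) ≥ 1`, `π ≤ 4`, `log 2 < 1`; the value is `≈ 1.6`). In particular Javanpeykar's
`h_F(E) ≤ 13·10⁶ deg_B(E)⁵` holds for these curves. [cite: Javanpeykar2014, Thm. 1.1.1] -/
theorem stableFaltingsHeight_le_three_of_j_eq_zero {K : Type*} [Field K] [NumberField K]
    (W : WeierstrassCurve K) [W.IsElliptic] (hj : W.j = 0) : W.stableFaltingsHeight ≤ 3 := by
  rw [stableFaltingsHeight_of_j_eq_zero W hj]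
  have hΓ : 1 ≤ Real.Gamma (1 / 3) := one_le_Gamma_of_le_one (by norm_num) (by norm_num)
  have hΓ0 : 0 < Real.Gamma (1 / 3) := by linarith
  have hπ : 0 < Real.pi := Real.pi_pos
  have hπ4 : Real.pi ≤ 4 := Real.pi_le_four
  rw [Real.log_div (pow_ne_zero _ hΓ0.ne') (by positivity), Real.log_pow,
    Real.log_mul (by norm_num) (by positivity), Real.log_pow]
  have h1 : 0 ≤ Real.log (Real.Gamma (1 / 3)) := Real.log_nonneg hΓ
  have h2 : Real.log Real.pi ≤ Real.log 4 := Real.log_le_log hπ hπ4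
  have h3 : Real.log 4 ≤ 2 := by
    rw [show (4 : ℝ) = 2 ^ 2 by norm_num, Real.log_pow]
    have := Real.log_two_lt_d9; norm_num at this ⊢; linarith
  have h4 : 0 ≤ Real.log (729 / 64) := Real.log_nonneg (by norm_num)
  have h5 : 0 ≤ Real.log 64 := Real.log_nonneg (by norm_num)
  have h6 : Real.log 64 ≤ 6 := by
    rw [show (64 : ℝ) = 2 ^ 6 by norm_num, Real.log_pow]
    have := Real.log_two_lt_d9; norm_num at this ⊢; linarith
  push_cast
  linarith

/-! ### The curves with `j = 1728`: the Gaussian lattice `ℤi + ℤ` -/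

namespace FaltingsHeightJ1728

/-- `g₂(Λ_i)`, the invariant of the Gaussian lattice `ℤi + ℤ` (`= Γ(1/4)⁸/(16π²) > 0`,
`GaussianLattice.g₂_eq_Gamma`). [folklore] -/
abbrev γ : ℂ := (ofUpperHalfPlane UpperHalfPlane.I).g₂

/-- `g₂(Λ_i) = Γ(1/4)⁸/(16π²)`, as a real number cast. [folklore] -/
theorem γ_eq : γ = ((Real.Gamma (1 / 4) ^ 8 / (16 * Real.pi ^ 2) : ℝ) : ℂ) := by
  rw [γ, GaussianLattice.g₂_eq_Gamma]; push_cast; ring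

/-- `g₂(Λ_i) > 0` (as a real number). [folklore] -/
theorem γ_re_pos : 0 < Real.Gamma (1 / 4) ^ 8 / (16 * Real.pi ^ 2) := by
  have h := GaussianLattice.g₂_re_pos
  rw [show (ofUpperHalfPlane UpperHalfPlane.I).g₂ = γ from rfl, γ_eq, Complex.ofReal_re] at h
  exact h

/-- `g₂(Λ_i) ≠ 0`. [folklore] -/
theorem γ_ne_zero : γ ≠ 0 := by
  rw [γ_eq, Complex.ofReal_ne_zero]; exact γ_re_pos.ne'

/-- The model `W_i : y² = x³ − (g₂(Λ_i)/4) x`, whose period lattice for `ω = dx/(2y)` is `Λ_i`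
(`c₄ = 12 g₂(Λ_i)`, `c₆ = 0 = 216 g₃(Λ_i)`). [folklore] -/
def Wi : WeierstrassCurve ℂ := ⟨0, 0, 0, -(γ / 4), 0⟩

/-- `c₄(W_i) = 12 g₂(Λ_i)`. [folklore] -/
theorem Wi_c₄ : Wi.c₄ = 12 * γ := by
  simp [Wi, WeierstrassCurve.c₄, WeierstrassCurve.b₂, WeierstrassCurve.b₄]; ring

/-- `c₆(W_i) = 0`. [folklore] -/
theorem Wi_c₆ : Wi.c₆ = 0 := by
  simp [Wi, WeierstrassCurve.c₆, WeierstrassCurve.b₂, WeierstrassCurve.b₄, WeierstrassCurve.b₆]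

/-- `Δ(W_i) = g₂(Λ_i)³`. [folklore] -/
theorem Wi_Δ : Wi.Δ = γ ^ 3 := by
  simp [Wi, WeierstrassCurve.Δ, WeierstrassCurve.b₂, WeierstrassCurve.b₄, WeierstrassCurve.b₆,
    WeierstrassCurve.b₈]
  ring

/-- `W_i` is an elliptic curve (`g₂(Λ_i) ≠ 0`). [folklore] -/
instance Wi_isElliptic : Wi.IsElliptic :=
  ⟨by rw [isUnit_iff_ne_zero, Wi_Δ]; exact pow_ne_zero 3 γ_ne_zero⟩

/-- `j(W_i) = 1728` (`c₄³ = 1728 Δ`). [folklore] -/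
theorem Wi_j : Wi.j = 1728 := by
  have h : Wi.c₄ ^ 3 = 1728 * Wi.Δ := by rw [Wi_c₄, Wi_Δ]; ring
  have hΔ : (Wi.Δ'⁻¹ : ℂˣ) * Wi.Δ = 1 := by
    rw [← WeierstrassCurve.coe_Δ', Units.inv_mul]
  rw [WeierstrassCurve.j]
  linear_combination (↑Wi.Δ'⁻¹ : ℂ) * h + (1728 : ℂ) * hΔ

/-- **The complex period of `W_i` is `2 covol(Λ_i) = 2`.** [cite: SilvermanAEC2009, Thm VI.5.1] -/
theorem Wi_complexPeriod : Wi.complexPeriod = 2 := by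
  rw [WeierstrassCurve.complexPeriod_eq_two_mul_covolume' (W := Wi)
      (L := ofUpperHalfPlane UpperHalfPlane.I) (by rw [Wi_c₄]; ring)
      (by rw [g₃_ofUpperHalfPlane_I, Wi_c₆, zero_div]),
    ModularForms.covolume_ofUpperHalfPlane_lattice, UpperHalfPlane.I_im, mul_one]

/-- **The archimedean term of `W_i`: `log|Δ| + 6 log((i/2)∫ω∧ω̄) = 3 log g₂(Λ_i)`.**
[cite: Silverman1986, Prop. 1.1] -/
theorem Wi_faltingsArchTerm :
    Wi.faltingsArchTerm = 3 * Real.log (Real.Gamma (1 / 4) ^ 8 / (16 * Real.pi ^ 2)) := by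
  have hγ := γ_re_pos
  set g : ℝ := Real.Gamma (1 / 4) ^ 8 / (16 * Real.pi ^ 2) with hg
  rw [WeierstrassCurve.faltingsArchTerm, Wi_Δ, Wi_complexPeriod, γ_eq, ← hg]
  have hnorm : ‖(g : ℂ) ^ 3‖ = g ^ 3 := by
    rw [norm_pow, Complex.norm_real, Real.norm_of_nonneg hγ.le]
  rw [hnorm, Real.log_pow, div_self two_ne_zero, Real.log_one, mul_zero, add_zero]
  push_cast
  ring

/-- **Every complex elliptic curve with `j = 1728` has the archimedean term of `W_i`.**
[cite: Silverman1986, proof of Prop. 1.1 (p. 255)] -/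
theorem faltingsArchTerm_of_j_eq_1728 (V : WeierstrassCurve ℂ) [V.IsElliptic] (hj : V.j = 1728) :
    V.faltingsArchTerm = 3 * Real.log (Real.Gamma (1 / 4) ^ 8 / (16 * Real.pi ^ 2)) := by
  obtain ⟨C, hC⟩ := WeierstrassCurve.exists_variableChange_of_j_eq V Wi (hj.trans Wi_j.symm)
  rw [← Wi_faltingsArchTerm, ← hC, WeierstrassCurve.faltingsArchTerm_smul]

end FaltingsHeightJ1728

open FaltingsHeightJ1728 in
/-- **The stable Faltings height of a `j = 1728` curve over a number field**:
`h_F(E) = −(1/4) log(Γ(1/4)⁸/(16π²))` (`j = 1728` is integral; every complex embedding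
contributes `3 log g₂(Λ_i)`). [cite: Silverman1986, Prop. 1.1 and §2] -/
theorem stableFaltingsHeight_of_j_eq_1728 {K : Type*} [Field K] [NumberField K]
    (W : WeierstrassCurve K) [W.IsElliptic] (hj : W.j = 1728) :
    W.stableFaltingsHeight = -(1 / 4) * Real.log (Real.Gamma (1 / 4) ^ 8 / (16 * Real.pi ^ 2)) := by
  have htop : W.jDenominatorIdeal = ⊤ := by
    rw [Ideal.eq_top_iff_one, WeierstrassCurve.one_mem_jDenominatorIdeal_iff]
    exact ⟨1728, by rw [hj]; rfl⟩
  have hσ : ∀ σ : K →+* ℂ, (W.map σ).faltingsArchTerm =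
      3 * Real.log (Real.Gamma (1 / 4) ^ 8 / (16 * Real.pi ^ 2)) := fun σ ↦ by
    haveI : (W.map σ).IsElliptic := by infer_instance
    exact faltingsArchTerm_of_j_eq_1728 _ (by rw [WeierstrassCurve.map_j, hj, map_ofNat])
  have hd : (Module.finrank ℚ K : ℝ) ≠ 0 := by
    exact_mod_cast (Module.finrank_pos (R := ℚ) (M := K)).ne'
  rw [WeierstrassCurve.stableFaltingsHeight, htop, Ideal.absNorm_top, Nat.cast_one, Real.log_one,
    Finset.sum_congr rfl fun σ _ ↦ hσ σ, Finset.sum_const, Finset.card_univ,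
    NumberField.Embeddings.card K ℂ, nsmul_eq_mul]
  field_simp
  ring

/-- **`h_F(E) ≤ 3` for every elliptic curve with `j = 1728` over a number field** (crude:
`Γ(1/4) ≥ 1`, `π ≤ 4`; the value is `≈ −1.3`). [cite: Javanpeykar2014, Thm. 1.1.1] -/
theorem stableFaltingsHeight_le_three_of_j_eq_1728 {K : Type*} [Field K] [NumberField K]
    (W : WeierstrassCurve K) [W.IsElliptic] (hj : W.j = 1728) : W.stableFaltingsHeight ≤ 3 := by
  rw [stableFaltingsHeight_of_j_eq_1728 W hj]
  have hΓ : 1 ≤ Real.Gamma (1 / 4) := one_le_Gamma_of_le_one (by norm_num) (by norm_num)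
  have hΓ0 : 0 < Real.Gamma (1 / 4) := by linarith
  have hπ : 0 < Real.pi := Real.pi_pos
  have hπ4 : Real.pi ≤ 4 := Real.pi_le_four
  rw [Real.log_div (pow_ne_zero _ hΓ0.ne') (by positivity), Real.log_pow,
    Real.log_mul (by norm_num) (by positivity), Real.log_pow]
  have h1 : 0 ≤ Real.log (Real.Gamma (1 / 4)) := Real.log_nonneg hΓ
  have h2 : Real.log Real.pi ≤ Real.log 4 := Real.log_le_log hπ hπ4
  have h3 : Real.log 4 ≤ 2 := by
    rw [show (4 : ℝ) = 2 ^ 2 by norm_num, Real.log_pow]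
    have := Real.log_two_lt_d9; norm_num at this ⊢; linarith
  have h5 : 0 ≤ Real.log 16 := Real.log_nonneg (by norm_num)
  have h6 : Real.log 16 ≤ 4 := by
    rw [show (16 : ℝ) = 2 ^ 4 by norm_num, Real.log_pow]
    have := Real.log_two_lt_d9; norm_num at this ⊢; linarith
  push_cast
  linarith

/-! ### Javanpeykar's inequality for the curves with `j = 0`, unconditionally -/

open scoped IntermediateField in
open AlgFunctionField in
/-- **`javanpeykar2014_stableFaltingsHeight_le` holds for every elliptic curve with `j = 0`**:
`h_F(E) ≤ 3 ≤ 13·10⁶ ≤ 13·10⁶ · [Ω(E) : Ω(f)]⁵` for every Belyi function `f` (its degree is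
`≥ deg_B(E_Ω) ≥ 3`, `three_le_belyiDegree_baseChange`). The named fact itself (all curves) is
Javanpeykar's theorem; this is its restriction to `j = 0`, with the same binders.
[cite: Javanpeykar2014, Thm. 1.1.1] -/
theorem javanpeykar2014_stableFaltingsHeight_le_of_j_eq_zero
    (K : Type) [Field K] [NumberField K] (W : WeierstrassCurve K) [W.IsElliptic] (hj : W.j = 0)
    (Ω : Type) [Field Ω] [Algebra K Ω] [IsAlgClosure K Ω]
    (f : (W.baseChange Ω).toAffine.FunctionField) (hf : IsBelyiFunction Ω f) :
    W.stableFaltingsHeight ≤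
      13 * 10 ^ 6 * (Module.finrank Ω⟮f⟯ (W.baseChange Ω).toAffine.FunctionField : ℝ) ^ 5 := by
  have h3 := stableFaltingsHeight_le_three_of_j_eq_zero W hj
  have hd : (1 : ℝ) ≤ Module.finrank Ω⟮f⟯ (W.baseChange Ω).toAffine.FunctionField := by
    have h1 := three_le_belyiDegree_baseChange K W Ω
    have h2 := belyiDegree_le_finrank hf
    exact_mod_cast (show 1 ≤ Module.finrank Ω⟮f⟯ (W.baseChange Ω).toAffine.FunctionField by omega)
  have hd5 : (1 : ℝ) ≤ (Module.finrank Ω⟮f⟯ (W.baseChange Ω).toAffine.FunctionField : ℝ) ^ 5 :=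
    one_le_pow₀ hd
  nlinarith

open scoped IntermediateField in
open AlgFunctionField in
/-- **`javanpeykar2014_stableFaltingsHeight_le` holds for every elliptic curve with `j = 1728`**
(`h_F(E) ≤ 3`; these are curves of Belyi degree `4`, `BelyiDegreeThreeJZero`).
[cite: Javanpeykar2014, Thm. 1.1.1] -/
theorem javanpeykar2014_stableFaltingsHeight_le_of_j_eq_1728
    (K : Type) [Field K] [NumberField K] (W : WeierstrassCurve K) [W.IsElliptic] (hj : W.j = 1728)
    (Ω : Type) [Field Ω] [Algebra K Ω] [IsAlgClosure K Ω]
    (f : (W.baseChange Ω).toAffine.FunctionField) (hf : IsBelyiFunction Ω f) :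
    W.stableFaltingsHeight ≤
      13 * 10 ^ 6 * (Module.finrank Ω⟮f⟯ (W.baseChange Ω).toAffine.FunctionField : ℝ) ^ 5 := by
  have h3 := stableFaltingsHeight_le_three_of_j_eq_1728 W hj
  have hd : (1 : ℝ) ≤ Module.finrank Ω⟮f⟯ (W.baseChange Ω).toAffine.FunctionField := by
    have h1 := three_le_belyiDegree_baseChange K W Ω
    have h2 := belyiDegree_le_finrank hf
    exact_mod_cast (show 1 ≤ Module.finrank Ω⟮f⟯ (W.baseChange Ω).toAffine.FunctionField by omega)
  have hd5 : (1 : ℝ) ≤ (Module.finrank Ω⟮f⟯ (W.baseChange Ω).toAffine.FunctionField : ℝ) ^ 5 :=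
    one_le_pow₀ hd
  nlinarith

end Literature.NumberTheory.DiophantineGeometry

end
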